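import Mathlib.NumberTheory.Padics.RingHoms
import Mathlib.NumberTheory.NumberField.InfinitePlace.TotallyRealComplex
import Mathlib.NumberTheory.NumberField.Units.DirichletTheorem
import Mathlib.Topology.Order.Compact
import Literature.NumberTheory.EllipticCurves.ZpExtension
import HarnessLib

/-!
# The anticyclotomic `ℤ_p`-character from the `ℤ_p`-rank: the index-two descent (proofs only)

This file proves, in an abstract topological-group setting, the Galois-theoretic half of the
existence of the anticyclotomic `ℤ_p`-extension of an imaginary quadratic field
(`Literature.NumberTheory.EllipticCurves.ZpExtension.exists_isAnticyclotomic`, file `ZpExtension.lean`).  The class-field-theoretic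
half — the `ℤ_p`-rank `r₂ + 1` of the compositum of all `ℤ_p`-extensions (Washington, Thm. 13.4;
Lang, *Cyclotomic Fields I–II*, Ch. 5, Thm. 5.2) — is a named fact elsewhere; here it only enters
through the two hypotheses `hG` ("rank `≤ 1` over the big group") and `hH` ("two jointly
surjective characters of the small group") of `exists_surjective_anticyclotomic`.

## Setting

`res : H →ₜ* G` is a continuous injective homomorphism from a compact group `H` to a Hausdorff
topological group `G` (think `Γ_K → Γ_ℚ` for a quadratic field `K`), whose image has index two in
the sense `hidx : ∀ ρ ρ' ∉ range res, ρ⁻¹ ρ' ∈ range res`, and `c ∈ G ∖ range res` with `c² = 1`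
(think: a complex conjugation, `K` imaginary).

## Main results (all `theorem`s; no definitions)

* `IndexTwo.conj_mem_range`: the image of `res` is normal.
* `IndexTwo.exists_conjHom`: conjugation by `ρ ∈ G` lifts to a continuous automorphism
  `θ : H →ₜ* H` with `res (θ σ) = ρ (res σ) ρ⁻¹`; for `ρ = c` it is an involution
  (`IndexTwo.conjHom_conjHom`).
* `IndexTwo.exists_extension`: a continuous character `f : H →ₜ* M` (`M` abelian) with
  `f ∘ θ = f` extends to `G` (the semidirect product `G = res(H) ⋊ ⟨c⟩` splits).
* `IndexTwo.anticyclotomic_of_anticyclotomicAt`: if `κ ∘ θ = κ⁻¹` then every `ρ ∉ range res`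
  acts on `κ` by `-1` (the shape of `Literature.NumberTheory.EllipticCurves.ZpExtension.IsAnticyclotomic`).
* `exists_surjective_of_ne_one`: a non-trivial continuous `g : H →ₜ* ℤ_p` (`H` compact) is
  `p^k · g'` with `g'` *surjective* (closed subgroups of `ℤ_p` are `p^k ℤ_p`; saturation step).
* `IndexTwo.exists_surjective_anticyclotomic`: under `hG` and `hH` there is a surjective
  `κ : H →ₜ* ℤ_p` on which every `ρ ∈ G ∖ res(H)` acts by `-1`.  Proof: if both given characters
  `κ₁, κ₂` of `H` were `θ`-invariant they would extend to `G` and be `ℤ_p`-dependent there (`hG`),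
  contradicting their joint surjectivity; so some `g = κᵢ / κᵢ∘θ ≠ 1` satisfies `g ∘ θ = g⁻¹`, and
  its saturation `g'` is the required `κ`.  This is the `(-1)`-eigenspace argument of
  Greenberg (1987), §2 ("`c` acts on `Gal(K_∞⁻/K)` by `-1`") and Washington §13.1, made choice-free.

The number-field specialisation (discharging `hidx`, `c ∉ range res` and the rank hypotheses) is
carried out in a sibling file; this file is pure topological group theory plus `ℤ_p`-arithmetic.

## References

* [Greenberg1987] R. Greenberg, *Non-vanishing of certain values of L-functions*, Progr. Math. 70
  (1987), §2.
* [Washington1997] L. C. Washington, *Introduction to Cyclotomic Fields*, 2nd ed., §13.1, Thm. 13.4.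
* S. Lang, *Cyclotomic Fields I and II*, GTM 121 (1990), Ch. 5 §5, Thm. 5.2.
-/

noncomputable section

open scoped Topology
open Topology Filter Set

namespace Literature.NumberTheory.EllipticCurves

namespace ZpExtension

/-! ### Saturation of a `ℤ_p`-valued character -/

section Saturation

variable {H : Type*} [Group H] [TopologicalSpace H] [CompactSpace H] {p : ℕ} [Fact p.Prime]

/-- **Saturation.**  A non-trivial continuous homomorphism `g : H →ₜ* ℤ_p` from a compact group is
of the form `p^k · g'` with `g' : H →ₜ* ℤ_p` continuous and *surjective*: take `k` the minimal
valuation of a value of `g` (a value of maximal norm exists by compactness), divide, and note that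
the image of `g'` is a closed subgroup of `ℤ_p` containing a unit `u`, hence containing the closure
`ℤ_p · u = ℤ_p` of `ℕ · u`.  (Equivalently: closed subgroups of `ℤ_p` are the ideals `p^k ℤ_p`.)
Ref: Washington, *Introduction to Cyclotomic Fields*, §13.1. [folklore] -/
theorem exists_surjective_of_ne_one (g : H →ₜ* Multiplicative ℤ_[p]) (hg : g ≠ 1) :
    ∃ (g' : H →ₜ* Multiplicative ℤ_[p]) (k : ℕ),
      Function.Surjective g' ∧ ∀ σ, (g σ).toAdd = (p : ℤ_[p]) ^ k * (g' σ).toAdd := by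
  have hp : Nat.Prime p := Fact.out
  -- the additive avatar of `g`
  set ga : H → ℤ_[p] := fun σ => (g σ).toAdd with hga_def
  have hga_cont : Continuous ga := continuous_toAdd.comp g.continuous
  have hga_mul : ∀ σ τ, ga (σ * τ) = ga σ + ga τ := fun σ τ => by
    simp only [hga_def, map_mul, toAdd_mul]
  have hga_one : ga 1 = 0 := by simp only [hga_def, map_one, toAdd_one]
  -- a value of maximal norm
  obtain ⟨σ₀, -, hmax⟩ := isCompact_univ.exists_isMaxOn Set.univ_nonempty
    ((continuous_norm.comp hga_cont).continuousOn (s := Set.univ))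
  have hle : ∀ σ, ‖ga σ‖ ≤ ‖ga σ₀‖ := fun σ => hmax (Set.mem_univ σ)
  have h0 : ga σ₀ ≠ 0 := by
    intro h0
    apply hg
    ext σ
    have h1 : ‖ga σ‖ ≤ 0 := by simpa only [h0, norm_zero] using hle σ
    have h2 : ga σ = 0 := norm_le_zero_iff.mp h1
    show g σ = 1
    exact Multiplicative.toAdd.injective (by rw [toAdd_one]; exact h2)
  set k : ℕ := (ga σ₀).valuation with hk_def
  have hnorm0 : ‖ga σ₀‖ = (p : ℝ) ^ (-(k : ℤ)) := PadicInt.norm_eq_zpow_neg_valuation h0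
  have hp0 : (p : ℚ_[p]) ≠ 0 := by exact_mod_cast hp.ne_zero
  have hpR : (0 : ℝ) < p := by exact_mod_cast hp.pos
  -- the divided function, first with values in `ℚ_p`
  set q : H → ℚ_[p] := fun σ => (ga σ : ℚ_[p]) * (p : ℚ_[p]) ^ (-(k : ℤ)) with hq_def
  have hq_cont : Continuous q :=
    (continuous_subtype_val.comp hga_cont).mul continuous_const
  have hq_norm : ∀ σ, ‖q σ‖ = ‖ga σ‖ * (p : ℝ) ^ (k : ℤ) := fun σ => by
    rw [hq_def]
    dsimp only
    rw [norm_mul, Padic.norm_p_zpow, neg_neg, PadicInt.padic_norm_e_of_padicInt]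
  have hq_le : ∀ σ, ‖q σ‖ ≤ 1 := fun σ => by
    rw [hq_norm]
    calc ‖ga σ‖ * (p : ℝ) ^ (k : ℤ) ≤ ‖ga σ₀‖ * (p : ℝ) ^ (k : ℤ) := by
          gcongr
          exact hle σ
      _ = 1 := by
          rw [hnorm0, ← zpow_add₀ hpR.ne', neg_add_cancel, zpow_zero]
  have hq_mul : ∀ σ τ, q (σ * τ) = q σ + q τ := fun σ τ => by
    simp only [hq_def, hga_mul, PadicInt.coe_add, add_mul]
  -- and then in `ℤ_p`
  set g'a : H → ℤ_[p] := fun σ => ⟨q σ, hq_le σ⟩ with hg'a_def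
  have hg'a_cont : Continuous g'a := hq_cont.subtype_mk _
  have hg'a_mul : ∀ σ τ, g'a (σ * τ) = g'a σ + g'a τ := fun σ τ => by
    apply Subtype.ext
    show q (σ * τ) = q σ + q τ
    exact hq_mul σ τ
  have hg'a_one : g'a 1 = 0 := by
    have h := hg'a_mul 1 1
    rw [mul_one, left_eq_add] at h
    exact h
  have hrel : ∀ σ, ga σ = (p : ℤ_[p]) ^ k * g'a σ := fun σ => by
    apply Subtype.ext
    show (ga σ : ℚ_[p]) = ((p : ℤ_[p]) ^ k : ℤ_[p]) * q σ
    rw [hq_def]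
    dsimp only
    rw [PadicInt.coe_pow, PadicInt.coe_natCast, mul_left_comm, ← zpow_natCast, ← zpow_add₀ hp0,
      add_neg_cancel, zpow_zero, mul_one]
  -- the continuous homomorphism
  let g' : H →ₜ* Multiplicative ℤ_[p] :=
    { toFun := fun σ => Multiplicative.ofAdd (g'a σ)
      map_one' := by rw [hg'a_one, ofAdd_zero]
      map_mul' := fun σ τ => by rw [hg'a_mul, ofAdd_add]
      continuous_toFun := continuous_ofAdd.comp hg'a_cont }
  have hg'_apply : ∀ σ, (g' σ).toAdd = g'a σ := fun σ => rfl
  refine ⟨g', k, ?_, fun σ => by rw [hg'_apply]; exact hrel σ⟩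
  -- surjectivity: the image is closed and contains `ℕ · u` for the unit `u = g'a σ₀`
  have hu : IsUnit (g'a σ₀) := by
    rw [PadicInt.isUnit_iff, PadicInt.norm_def]
    show ‖q σ₀‖ = 1
    rw [hq_norm, hnorm0, ← zpow_add₀ hpR.ne', neg_add_cancel, zpow_zero]
  obtain ⟨u, hu_eq⟩ := hu
  have hclosed : IsClosed (Set.range g'a) := (isCompact_range hg'a_cont).isClosed
  have hpow : ∀ n : ℕ, g'a (σ₀ ^ n) = (n : ℤ_[p]) * g'a σ₀ := by
    intro n
    induction n with
    | zero => rw [pow_zero, hg'a_one, Nat.cast_zero, zero_mul]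
    | succ n ih => rw [pow_succ, hg'a_mul, ih, Nat.cast_succ, add_mul, one_mul]
  have hdense : DenseRange (fun n : ℕ => (n : ℤ_[p]) * g'a σ₀) := by
    have hsurj : Function.Surjective (fun x : ℤ_[p] => x * g'a σ₀) := fun y =>
      ⟨y * ↑u⁻¹, by simp only [← hu_eq, Units.inv_mul_cancel_right]⟩
    exact hsurj.denseRange.comp PadicInt.denseRange_natCast (continuous_id.mul continuous_const)
  have hsub : Set.range (fun n : ℕ => (n : ℤ_[p]) * g'a σ₀) ⊆ Set.range g'a := by
    rintro _ ⟨n, rfl⟩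
    exact ⟨σ₀ ^ n, hpow n⟩
  have huniv : Set.range g'a = Set.univ := by
    apply Set.eq_univ_of_univ_subset
    rw [← hdense.closure_range]
    exact closure_minimal hsub hclosed
  intro y
  obtain ⟨σ, hσ⟩ : y.toAdd ∈ Set.range g'a := by rw [huniv]; exact Set.mem_univ _
  exact ⟨σ, Multiplicative.toAdd.injective (by rw [hg'_apply, hσ])⟩

end Saturation

/-! ### The index-two setting -/

namespace IndexTwo

variable {G H : Type*} [Group G] [TopologicalSpace G] [Group H] [TopologicalSpace H]
  (res : H →ₜ* G)

/-- If the image of `res : H → G` has index at most two (any two elements outside it lie in one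
coset) then it is normal: `ρ (res σ) ρ⁻¹ ∈ res(H)`.  Ref: elementary group theory. [folklore] -/
theorem conj_mem_range
    (hidx : ∀ ρ ρ' : G, ρ ∉ Set.range res → ρ' ∉ Set.range res → ρ⁻¹ * ρ' ∈ Set.range res)
    (ρ : G) (σ : H) : ρ * res σ * ρ⁻¹ ∈ Set.range res := by
  by_cases hρ : ρ ∈ Set.range res
  · obtain ⟨α, rfl⟩ := hρ
    exact ⟨α * σ * α⁻¹, by rw [map_mul, map_mul, map_inv]⟩
  · by_contra h
    obtain ⟨β, hβ⟩ := hidx _ _ h hρ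
    apply hρ
    refine ⟨β * σ, ?_⟩
    rw [map_mul, hβ]
    group

/-- **Conjugation lifts.**  For `res : H →ₜ* G` continuous injective with `H` compact, `G`
Hausdorff and `res(H)` of index at most two, conjugation by any `ρ ∈ G` lifts to a continuous
homomorphism `θ : H →ₜ* H`, `res (θ σ) = ρ (res σ) ρ⁻¹` (`res` is a closed embedding, so `θ` is
continuous because `res ∘ θ` is).  Ref: Greenberg (1987), §2 (the action of `c` "as an inner
automorphism"). [folklore] -/
theorem exists_conjHom [IsTopologicalGroup G] [CompactSpace H] [T2Space G] (hinj : Function.Injective res)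
    (hidx : ∀ ρ ρ' : G, ρ ∉ Set.range res → ρ' ∉ Set.range res → ρ⁻¹ * ρ' ∈ Set.range res)
    (ρ : G) : ∃ θ : H →ₜ* H, ∀ σ, res (θ σ) = ρ * res σ * ρ⁻¹ := by
  have hmem : ∀ σ, ∃ τ, res τ = ρ * res σ * ρ⁻¹ := fun σ => conj_mem_range res hidx ρ σ
  choose t ht using hmem
  have hce : IsClosedEmbedding res := res.continuous.isClosedEmbedding hinj
  refine ⟨⟨⟨⟨t, ?_⟩, ?_⟩, ?_⟩, ht⟩
  · apply hinj
    rw [ht, map_one, mul_one, mul_inv_cancel]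
  · intro a b
    apply hinj
    show res (t (a * b)) = res (t a * t b)
    rw [ht, map_mul, map_mul, ht, ht]
    group
  · show Continuous t
    rw [hce.isEmbedding.continuous_iff]
    have : (res ∘ t) = fun σ => ρ * res σ * ρ⁻¹ := funext ht
    rw [this]
    exact (continuous_const.mul res.continuous).mul continuous_const

variable {res}

/-- The lift of conjugation by an element `c` with `c² = 1` is an involution: `θ (θ σ) = σ`.
[folklore] -/
theorem conjHom_conjHom (hinj : Function.Injective res) {c : G} (hc2 : c * c = 1)
    {θ : H →ₜ* H} (hθ : ∀ σ, res (θ σ) = c * res σ * c⁻¹) (σ : H) : θ (θ σ) = σ := by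
  have hcinv : c⁻¹ = c := inv_eq_of_mul_eq_one_right hc2
  apply hinj
  rw [hθ, hθ, hcinv, ← mul_assoc, ← mul_assoc, hc2, one_mul, mul_assoc, hc2, mul_one]

/-- Uniqueness of the lift: `res τ = c (res σ) c⁻¹` forces `τ = θ σ` (`res` injective).
[folklore] -/
theorem eq_conjHom_of_res_eq (hinj : Function.Injective res) {c : G}
    {θ : H →ₜ* H} (hθ : ∀ σ, res (θ σ) = c * res σ * c⁻¹) {σ τ : H}
    (h : res τ = c * res σ * c⁻¹) : τ = θ σ :=
  hinj (by rw [h, hθ])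

/-- `res σ · c = c · res (θ σ)` when `c² = 1` (moving `c` across an element of `res(H)`).
[folklore] -/
theorem res_mul_eq (_hinj : Function.Injective res) {c : G} (hc2 : c * c = 1)
    {θ : H →ₜ* H} (hθ : ∀ σ, res (θ σ) = c * res σ * c⁻¹) (σ : H) :
    res σ * c = c * res (θ σ) := by
  have hcinv : c⁻¹ = c := inv_eq_of_mul_eq_one_right hc2
  rw [hθ, hcinv, ← mul_assoc, ← mul_assoc, hc2, one_mul]

/-- An element `c ∉ res(H)` times an element of `res(H)` is not in `res(H)`. [folklore] -/
theorem mul_res_not_mem_range {c : G} (hc : c ∉ Set.range res) (α : H) :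
    c * res α ∉ Set.range res := by
  rintro ⟨β, hβ⟩
  exact hc ⟨β * α⁻¹, by rw [map_mul, map_inv, hβ, mul_inv_cancel_right]⟩

/-- **Coset decomposition.**  With `res(H)` of index at most two and `c ∉ res(H)`, `c⁻¹ = c`,
every `ρ ∈ G` is `res α` or `c · res α`.  [folklore] -/
theorem eq_res_or_eq_mul_res {c : G} (hc : c ∉ Set.range res) (hc2 : c * c = 1)
    (hidx : ∀ ρ ρ' : G, ρ ∉ Set.range res → ρ' ∉ Set.range res → ρ⁻¹ * ρ' ∈ Set.range res)
    (ρ : G) : (∃ α, ρ = res α) ∨ (∃ α, ρ = c * res α) := by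
  by_cases hρ : ρ ∈ Set.range res
  · obtain ⟨α, rfl⟩ := hρ
    exact Or.inl ⟨α, rfl⟩
  · obtain ⟨α, hα⟩ := hidx c ρ hc hρ
    have hcinv : c⁻¹ = c := inv_eq_of_mul_eq_one_right hc2
    refine Or.inr ⟨α, ?_⟩
    rw [hα, hcinv, ← mul_assoc, hc2, one_mul]

/-- `res(H)` is open in `G` (`H` compact, `G` Hausdorff, index at most two): its complement is the
compact coset `c · res(H)`.  [folklore] -/
theorem isOpen_range [IsTopologicalGroup G] [CompactSpace H] [T2Space G] {c : G} (hc : c ∉ Set.range res)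
    (hc2 : c * c = 1)
    (hidx : ∀ ρ ρ' : G, ρ ∉ Set.range res → ρ' ∉ Set.range res → ρ⁻¹ * ρ' ∈ Set.range res) :
    IsOpen (Set.range res) := by
  have hcompl : (Set.range res)ᶜ = (fun x => c * x) '' Set.range res := by
    ext ρ
    constructor
    · intro hρ
      rcases eq_res_or_eq_mul_res hc hc2 hidx ρ with ⟨α, rfl⟩ | ⟨α, rfl⟩
      · exact absurd (Set.mem_range_self α) hρ
      · exact ⟨res α, Set.mem_range_self α, rfl⟩
    · rintro ⟨_, ⟨α, rfl⟩, rfl⟩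
      exact mul_res_not_mem_range hc α
  have hclosed : IsClosed ((fun x => c * x) '' Set.range res) :=
    ((isCompact_range res.continuous).image (continuous_const.mul continuous_id)).isClosed
  rw [← isClosed_compl_iff, hcompl]
  exact hclosed

/-- **Extension of `θ`-invariant characters.**  Let `M` be an abelian topological group and
`f : H →ₜ* M` with `f (θ σ) = f σ` for the lift `θ` of conjugation by `c` (`c ∉ res(H)`, `c² = 1`,
index two).  Then `f` extends to a continuous homomorphism `F : G →ₜ* M`, `F (res σ) = f σ`
(set `F (res α) = F (c · res α) = f α`; continuity at `1` because `res` is an open embedding).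
Ref: Greenberg (1987), §2; Washington, §13.1 (a `ℤ_p`-extension of `K` on which `c` acts
trivially descends to an abelian extension of `ℚ`). [folklore] -/
theorem exists_extension [IsTopologicalGroup G] [CompactSpace H] [T2Space G] {M : Type*} [CommGroup M]
    [TopologicalSpace M] [IsTopologicalGroup M] (hinj : Function.Injective res) {c : G}
    (hc : c ∉ Set.range res) (hc2 : c * c = 1)
    (hidx : ∀ ρ ρ' : G, ρ ∉ Set.range res → ρ' ∉ Set.range res → ρ⁻¹ * ρ' ∈ Set.range res)
    {θ : H →ₜ* H} (hθ : ∀ σ, res (θ σ) = c * res σ * c⁻¹) (f : H →ₜ* M)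
    (hf : ∀ σ, f (θ σ) = f σ) : ∃ F : G →ₜ* M, ∀ σ, F (res σ) = f σ := by
  classical
  have key : ∀ ρ, ρ ∉ Set.range res → c⁻¹ * ρ ∈ Set.range res := fun ρ h => hidx c ρ hc h
  -- a set-theoretic section of `G → G / res(H) = {1, c}` followed by `res⁻¹`
  let s : G → H := fun ρ =>
    if h : ρ ∈ Set.range res then h.choose else (key ρ h).choose
  have s_res : ∀ α, s (res α) = α := fun α => by
    have h : res α ∈ Set.range res := Set.mem_range_self α
    have hs : s (res α) = h.choose := dif_pos h
    rw [hs]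
    exact hinj h.choose_spec
  have s_cres : ∀ α, s (c * res α) = α := fun α => by
    have h : c * res α ∉ Set.range res := mul_res_not_mem_range hc α
    have hs : s (c * res α) = (key _ h).choose := dif_neg h
    rw [hs]
    apply hinj
    rw [(key _ h).choose_spec, inv_mul_cancel_left]
  let Ff : G → M := fun ρ => f (s ρ)
  have F_res : ∀ α, Ff (res α) = f α := fun α => by
    show f (s (res α)) = f α
    rw [s_res]
  have F_cres : ∀ α, Ff (c * res α) = f α := fun α => by
    show f (s (c * res α)) = f α
    rw [s_cres]
  have F_one : Ff 1 = 1 := by rw [← map_one res, F_res, map_one]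
  have F_mul : ∀ x y, Ff (x * y) = Ff x * Ff y := by
    intro x y
    rcases eq_res_or_eq_mul_res hc hc2 hidx x with ⟨α, rfl⟩ | ⟨α, rfl⟩ <;>
      rcases eq_res_or_eq_mul_res hc hc2 hidx y with ⟨β, rfl⟩ | ⟨β, rfl⟩
    · rw [← map_mul, F_res, F_res, F_res, map_mul]
    · rw [← mul_assoc, res_mul_eq hinj hc2 hθ, mul_assoc, ← map_mul, F_cres, F_res, F_cres,
        map_mul, hf]
    · rw [mul_assoc, ← map_mul, F_cres, F_cres, F_res, map_mul]
    · rw [mul_assoc, ← mul_assoc (res α), res_mul_eq hinj hc2 hθ, ← mul_assoc, ← mul_assoc, hc2,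
        one_mul, ← map_mul, F_res, F_cres, F_cres, map_mul, hf]
  let Fm : G →* M := { toFun := Ff, map_one' := F_one, map_mul' := F_mul }
  -- continuity at `1`, via the open embedding `res`
  have hopen : IsOpen (Set.range res) := isOpen_range hc hc2 hidx
  have hoe : IsOpenEmbedding res := ⟨(res.continuous.isClosedEmbedding hinj).isEmbedding, hopen⟩
  have hcont1 : ContinuousAt Fm 1 := by
    rw [continuousAt_def]
    intro A hA
    have h1 : Fm 1 = f 1 := by rw [map_one, map_one]
    rw [h1] at hA
    have hA' : (f : H → M) ⁻¹' A ∈ 𝓝 (1 : H) := f.continuous.continuousAt.preimage_mem_nhds hA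
    obtain ⟨V, hVsub, hVopen, hV1⟩ := mem_nhds_iff.mp hA'
    refine mem_nhds_iff.mpr ⟨res '' V, ?_, hoe.isOpenMap V hVopen, ⟨1, hV1, map_one res⟩⟩
    rintro _ ⟨α, hα, rfl⟩
    show Ff (res α) ∈ A
    rw [F_res]
    exact hVsub hα
  refine ⟨⟨Fm, continuous_of_continuousAt_one Fm hcont1⟩, fun σ => ?_⟩
  show Ff (res σ) = f σ
  exact F_res σ

/-- **From one to all.**  If `κ : H →ₜ* M` (`M` abelian) satisfies `κ (θ σ) = (κ σ)⁻¹` for the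
lift `θ` of conjugation by `c`, then every `ρ ∈ G ∖ res(H)` acts on `κ` by inversion: whenever
`res τ = ρ (res σ) ρ⁻¹` one has `κ τ = (κ σ)⁻¹` (write `ρ = c · res α` and use that inner
automorphisms of `H` act trivially on the abelian character `κ`).  This is exactly the shape of
`Literature.NumberTheory.EllipticCurves.ZpExtension.IsAnticyclotomic`.  Ref: Greenberg (1987), §2. [folklore] -/
theorem anticyclotomic_of_anticyclotomicAt {M : Type*} [CommGroup M] [TopologicalSpace M]
    (hinj : Function.Injective res) {c : G} (hc : c ∉ Set.range res) (hc2 : c * c = 1)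
    (hidx : ∀ ρ ρ' : G, ρ ∉ Set.range res → ρ' ∉ Set.range res → ρ⁻¹ * ρ' ∈ Set.range res)
    {θ : H →ₜ* H} (hθ : ∀ σ, res (θ σ) = c * res σ * c⁻¹) (κ : H →ₜ* M)
    (hκ : ∀ σ, κ (θ σ) = (κ σ)⁻¹) (σ τ : H) (ρ : G) (hρ : ρ ∉ Set.range res)
    (h : res τ = ρ * res σ * ρ⁻¹) : κ τ = (κ σ)⁻¹ := by
  rcases eq_res_or_eq_mul_res hc hc2 hidx ρ with ⟨α, rfl⟩ | ⟨α, rfl⟩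
  · exact absurd (Set.mem_range_self α) hρ
  · have h' : res τ = c * res (α * σ * α⁻¹) * c⁻¹ := by
      rw [h, map_mul, map_mul, map_inv, mul_inv_rev]
      group
    rw [eq_conjHom_of_res_eq hinj hθ h', hκ, map_mul, map_mul, map_inv, mul_inv_cancel_comm]

/-- **The anticyclotomic character from the rank count.**  In the index-two setting (`res`
injective, `H` compact, `G` Hausdorff, `c ∉ res(H)`, `c² = 1`), assume
* `hG`: any two continuous characters `G →ₜ* ℤ_p` are `ℤ_p`-linearly dependent
  (`ℤ_p`-rank `≤ 1`; for `G = Γ_ℚ`: `ℚ` has a unique `ℤ_p`-extension), and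
* `hH`: `H` has two continuous characters `κ₁, κ₂ : H →ₜ* ℤ_p` with `(κ₁, κ₂) : H → ℤ_p²`
  surjective (`ℤ_p`-rank `≥ 2`; for `H = Γ_K`, `K` imaginary quadratic: `Gal(K̃/K) ≃ ℤ_p²`).
Then there is a *surjective* `κ : H →ₜ* ℤ_p` on which every `ρ ∈ G ∖ res(H)` acts by `-1`.
Proof: if both `κᵢ` were `θ`-invariant they would extend to `G` (`exists_extension`) and be
dependent (`hG`), contradicting joint surjectivity; hence some `g = κᵢ / κᵢ ∘ θ` is non-trivial with
`g ∘ θ = g⁻¹`, and its saturation (`exists_surjective_of_ne_one`) is the required `κ`.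
Ref: Greenberg (1987), §2; Washington, §13.1 and Thm. 13.4. [folklore] -/
theorem exists_surjective_anticyclotomic [IsTopologicalGroup G] [CompactSpace H] [T2Space G] {p : ℕ} [Fact p.Prime]
    (hinj : Function.Injective res) {c : G} (hc : c ∉ Set.range res) (hc2 : c * c = 1)
    (hidx : ∀ ρ ρ' : G, ρ ∉ Set.range res → ρ' ∉ Set.range res → ρ⁻¹ * ρ' ∈ Set.range res)
    (hG : ∀ F₁ F₂ : G →ₜ* Multiplicative ℤ_[p], ∃ a b : ℤ_[p], (a ≠ 0 ∨ b ≠ 0) ∧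
      ∀ ρ, a * (F₁ ρ).toAdd = b * (F₂ ρ).toAdd)
    (hH : ∃ κ₁ κ₂ : H →ₜ* Multiplicative ℤ_[p],
      Function.Surjective fun σ => ((κ₁ σ).toAdd, (κ₂ σ).toAdd)) :
    ∃ κ : H →ₜ* Multiplicative ℤ_[p], Function.Surjective κ ∧
      ∀ (σ τ : H) (ρ : G), ρ ∉ Set.range res → res τ = ρ * res σ * ρ⁻¹ → κ τ = (κ σ)⁻¹ := by
  obtain ⟨θ, hθ⟩ := exists_conjHom res hinj hidx c
  obtain ⟨κ₁, κ₂, hsurj⟩ := hH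
  -- Step 1: one of `κ₁, κ₂` is not `θ`-invariant.
  have hex : ∃ κ₀ : H →ₜ* Multiplicative ℤ_[p], ∃ σ₁, κ₀ (θ σ₁) ≠ κ₀ σ₁ := by
    by_contra hall
    push Not at hall
    obtain ⟨F₁, hF₁⟩ := exists_extension hinj hc hc2 hidx hθ κ₁ (hall κ₁)
    obtain ⟨F₂, hF₂⟩ := exists_extension hinj hc hc2 hidx hθ κ₂ (hall κ₂)
    obtain ⟨a, b, hab, hdep⟩ := hG F₁ F₂
    have hdep' : ∀ σ, a * (κ₁ σ).toAdd = b * (κ₂ σ).toAdd := fun σ => by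
      rw [← hF₁, ← hF₂]
      exact hdep _
    obtain ⟨σa, hσa⟩ := hsurj (1, 0)
    obtain ⟨σb, hσb⟩ := hsurj (0, 1)
    simp only [Prod.mk.injEq] at hσa hσb
    have ha : a = 0 := by simpa only [hσa.1, hσa.2, mul_one, mul_zero] using hdep' σa
    have hb : b = 0 := by simpa only [hσb.1, hσb.2, mul_one, mul_zero] using (hdep' σb).symm
    exact hab.elim (fun h => h ha) (fun h => h hb)
  obtain ⟨κ₀, σ₁, hσ₁⟩ := hex
  -- Step 2: `g = κ₀ / κ₀ ∘ θ` is non-trivial and `θ`-anti-invariant.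
  let g : H →ₜ* Multiplicative ℤ_[p] := κ₀ / κ₀.comp θ
  have hg_apply : ∀ σ, g σ = κ₀ σ / κ₀ (θ σ) := fun σ => rfl
  have hg1 : g ≠ 1 := by
    intro h1
    apply hσ₁
    have := congrArg (fun φ : H →ₜ* Multiplicative ℤ_[p] => φ σ₁) h1
    simp only [hg_apply] at this
    exact (div_eq_one.mp this).symm
  have hgθ : ∀ σ, g (θ σ) = (g σ)⁻¹ := fun σ => by
    rw [hg_apply, hg_apply, conjHom_conjHom hinj hc2 hθ, inv_div]
  -- Step 3: saturate.
  obtain ⟨g', k, hg'surj, hrel⟩ := exists_surjective_of_ne_one g hg1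
  have hp : Nat.Prime p := Fact.out
  have hpk : (p : ℤ_[p]) ^ k ≠ 0 := pow_ne_zero _ (by exact_mod_cast hp.ne_zero)
  have hg'θ : ∀ σ, g' (θ σ) = (g' σ)⁻¹ := fun σ => by
    apply Multiplicative.toAdd.injective
    apply mul_left_cancel₀ hpk
    rw [← hrel, hgθ, toAdd_inv, toAdd_inv, mul_neg, ← hrel]
  exact ⟨g', hg'surj, fun σ τ ρ hρ h =>
    anticyclotomic_of_anticyclotomicAt hinj hc hc2 hidx hθ g' hg'θ σ τ ρ hρ h⟩

end IndexTwo

/-! ### The number-field specialisation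

The remaining hypotheses of `IndexTwo.exists_surjective_anticyclotomic` for `res : Γ_K → Γ_ℚ`,
`K` imaginary quadratic, are of two kinds: Galois glue (`hidx`, and a complex conjugation
`c ∉ res(Γ_K)`, `c² = 1`), kept as hypotheses here, and the `ℤ_p`-rank statements, taken in the
literal shape of the named fact "`Gal(K̃/K) ≃ ℤ_p^{r₂+1}` for unit rank `0`" (Lang, Thm. 5.2;
Washington, Thm. 13.4) for `K` and for `ℚ`. -/

section NumberField

open NumberField NumberField.InfinitePlace Field

/-- `ℚ` has unit rank `r₁ + r₂ - 1 = 0`: it has exactly one infinite place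
(`Unique (InfinitePlace ℚ)` in Mathlib). [folklore] -/
theorem units_rank_rat : NumberField.Units.rank ℚ = 0 := by
  rw [NumberField.Units.rank, Fintype.card_unique]

universe u

variable {K : Type u} [Field K] [NumberField K]

/-- An imaginary quadratic field has exactly one complex place (`r₁ + 2 r₂ = 2`, `r₁ = 0`;
Mathlib's `IsTotallyComplex.finrank`). [folklore] -/
theorem nrComplexPlaces_eq_one_of_finrank_eq_two (hK : Module.finrank ℚ K = 2)
    (himag : ∀ w : InfinitePlace K, w.IsComplex) : nrComplexPlaces K = 1 := by
  haveI : IsTotallyComplex K := ⟨himag⟩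
  have h := IsTotallyComplex.finrank K
  omega

/-- An imaginary quadratic field has unit rank `r₁ + r₂ - 1 = 0`. [folklore] -/
theorem units_rank_eq_zero_of_finrank_eq_two (hK : Module.finrank ℚ K = 2)
    (himag : ∀ w : InfinitePlace K, w.IsComplex) : NumberField.Units.rank K = 0 := by
  haveI : IsTotallyComplex K := ⟨himag⟩
  rw [NumberField.Units.rank, card_eq_nrRealPlaces_add_nrComplexPlaces,
    IsTotallyComplex.nrRealPlaces_eq_zero K, nrComplexPlaces_eq_one_of_finrank_eq_two hK himag]

variable {p : ℕ} [Fact p.Prime]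

/-- **Rank `≤ 1` for `Γ_ℚ`.**  From "`Hom_cont(Γ_ℚ, ℤ_p)` is spanned by `r₂(ℚ) + 1 = 1` character"
(the shape of the named `ℤ_p`-rank fact for `ℚ`; `ℚ_∞/ℚ` is the unique `ℤ_p`-extension of `ℚ`)
any two continuous characters `Γ_ℚ →ₜ* ℤ_p` are `ℤ_p`-linearly dependent.
Ref: Washington, *Introduction to Cyclotomic Fields*, §13.1 and Thm. 13.4. [folklore] -/
theorem dependent_of_zpRank_rat
    (h : ∃ Φ : Fin (nrComplexPlaces ℚ + 1) → (absoluteGaloisGroup ℚ →ₜ* Multiplicative ℤ_[p]),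
      Function.Surjective (fun (σ : absoluteGaloisGroup ℚ) (i : Fin (nrComplexPlaces ℚ + 1)) =>
        (Φ i σ).toAdd) ∧
      ∀ f : absoluteGaloisGroup ℚ →ₜ* Multiplicative ℤ_[p],
        ∃ a : Fin (nrComplexPlaces ℚ + 1) → ℤ_[p], ∀ σ, (f σ).toAdd = ∑ i, a i * (Φ i σ).toAdd)
    (F₁ F₂ : absoluteGaloisGroup ℚ →ₜ* Multiplicative ℤ_[p]) :
    ∃ a b : ℤ_[p], (a ≠ 0 ∨ b ≠ 0) ∧ ∀ ρ, a * (F₁ ρ).toAdd = b * (F₂ ρ).toAdd := by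
  obtain ⟨Φ, -, hspan⟩ := h
  let i₀ : Fin (nrComplexPlaces ℚ + 1) := ⟨0, Nat.succ_pos _⟩
  have hi : ∀ i : Fin (nrComplexPlaces ℚ + 1), i = i₀ := fun i => by
    apply Fin.ext
    have hlt : i.val < nrComplexPlaces ℚ + 1 := i.isLt
    have h0 : nrComplexPlaces ℚ = 0 := IsTotallyReal.nrComplexPlaces_eq_zero ℚ
    show i.val = 0
    omega
  have hsum : ∀ (a : Fin (nrComplexPlaces ℚ + 1) → ℤ_[p]) (σ : absoluteGaloisGroup ℚ),
      ∑ i, a i * (Φ i σ).toAdd = a i₀ * (Φ i₀ σ).toAdd := fun a σ =>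
    Finset.sum_eq_single_of_mem i₀ (Finset.mem_univ _) (fun j _ hj => absurd (hi j) hj)
  obtain ⟨a₁, ha₁⟩ := hspan F₁
  obtain ⟨a₂, ha₂⟩ := hspan F₂
  by_cases hz : a₁ i₀ = 0
  · refine ⟨1, 0, Or.inl one_ne_zero, fun ρ => ?_⟩
    rw [ha₁, hsum, hz, zero_mul, mul_zero, zero_mul]
  · refine ⟨a₂ i₀, a₁ i₀, Or.inr hz, fun ρ => ?_⟩
    rw [ha₁, ha₂, hsum, hsum]
    ring

/-- **Rank `≥ 2` for `Γ_K`, `K` imaginary quadratic.**  From "`Γ_K → ℤ_p^{r₂+1}` jointly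
surjective" with `r₂ = 1` (the shape of the named `ℤ_p`-rank fact for `K`: `Gal(K̃/K) ≃ ℤ_p²`) we
extract two characters `κ₁, κ₂ : Γ_K →ₜ* ℤ_p` with `(κ₁, κ₂) : Γ_K → ℤ_p²` surjective.
Ref: Greenberg (1987), §2 ("`Gal(K̃_∞/K) ≅ ℤ_p²`"); Washington, Thm. 13.4. [folklore] -/
theorem exists_pair_of_zpRank (hK : Module.finrank ℚ K = 2)
    (himag : ∀ w : InfinitePlace K, w.IsComplex)
    (h : ∃ Φ : Fin (nrComplexPlaces K + 1) → (absoluteGaloisGroup K →ₜ* Multiplicative ℤ_[p]),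
      Function.Surjective (fun (σ : absoluteGaloisGroup K) (i : Fin (nrComplexPlaces K + 1)) =>
        (Φ i σ).toAdd) ∧
      ∀ f : absoluteGaloisGroup K →ₜ* Multiplicative ℤ_[p],
        ∃ a : Fin (nrComplexPlaces K + 1) → ℤ_[p], ∀ σ, (f σ).toAdd = ∑ i, a i * (Φ i σ).toAdd) :
    ∃ κ₁ κ₂ : absoluteGaloisGroup K →ₜ* Multiplicative ℤ_[p],
      Function.Surjective fun σ => ((κ₁ σ).toAdd, (κ₂ σ).toAdd) := by
  classical
  obtain ⟨Φ, hsurj, -⟩ := h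
  have h1 := nrComplexPlaces_eq_one_of_finrank_eq_two hK himag
  let i₀ : Fin (nrComplexPlaces K + 1) := ⟨0, Nat.succ_pos _⟩
  let i₁ : Fin (nrComplexPlaces K + 1) := ⟨1, by omega⟩
  have hne : i₁ ≠ i₀ := fun h => absurd (congrArg Fin.val h) Nat.one_ne_zero
  refine ⟨Φ i₀, Φ i₁, fun xy => ?_⟩
  obtain ⟨σ, hσ⟩ := hsurj (fun i => if i = i₀ then xy.1 else xy.2)
  refine ⟨σ, Prod.ext ?_ ?_⟩
  · have h0 := congrFun hσ i₀
    rw [if_pos rfl] at h0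
    exact h0
  · have h1' := congrFun hσ i₁
    rw [if_neg hne] at h1'
    exact h1'

/-- **`exists_isAnticyclotomic` from its inputs.**  Let `K` be imaginary quadratic.  Assume the
Galois glue (`hidx`: the image of `Γ_K → Γ_ℚ` has index at most two; `hconj`: some `c ∉ Γ_K`
with `c² = 1`, i.e. a complex conjugation) and the `ℤ_p`-rank statements for `ℚ` and for `K`
in the literal shape of the named fact "unit rank `0` ⇒ `Gal(K̃/K) ≃ ℤ_p^{r₂+1}`" (Lang, Thm. 5.2;
Washington, Thm. 13.4).  Then `K` has an anticyclotomic `ℤ_p`-extension in the sense of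
`Literature.NumberTheory.EllipticCurves.ZpExtension.IsAnticyclotomic`.  Ref: Greenberg (1987), §2; Washington, §13.1, Thm. 13.4.
[folklore] -/
theorem exists_isAnticyclotomic_of_zpRank (hK : Module.finrank ℚ K = 2)
    (himag : ∀ w : InfinitePlace K, w.IsComplex)
    (hidx : ∀ ρ ρ' : absoluteGaloisGroup ℚ, ρ ∉ Set.range (GaloisRepresentations.absGaloisRestrict ℚ K) →
      ρ' ∉ Set.range (GaloisRepresentations.absGaloisRestrict ℚ K) → ρ⁻¹ * ρ' ∈ Set.range (GaloisRepresentations.absGaloisRestrict ℚ K))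
    (hconj : ∃ c : absoluteGaloisGroup ℚ, c ∉ Set.range (GaloisRepresentations.absGaloisRestrict ℚ K) ∧ c * c = 1)
    (hℚ : NumberField.Units.rank ℚ = 0 →
      ∃ Φ : Fin (nrComplexPlaces ℚ + 1) → (absoluteGaloisGroup ℚ →ₜ* Multiplicative ℤ_[p]),
        Function.Surjective (fun (σ : absoluteGaloisGroup ℚ) (i : Fin (nrComplexPlaces ℚ + 1)) =>
          (Φ i σ).toAdd) ∧
        ∀ f : absoluteGaloisGroup ℚ →ₜ* Multiplicative ℤ_[p],
          ∃ a : Fin (nrComplexPlaces ℚ + 1) → ℤ_[p], ∀ σ, (f σ).toAdd = ∑ i, a i * (Φ i σ).toAdd)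
    (hKr : NumberField.Units.rank K = 0 →
      ∃ Φ : Fin (nrComplexPlaces K + 1) → (absoluteGaloisGroup K →ₜ* Multiplicative ℤ_[p]),
        Function.Surjective (fun (σ : absoluteGaloisGroup K) (i : Fin (nrComplexPlaces K + 1)) =>
          (Φ i σ).toAdd) ∧
        ∀ f : absoluteGaloisGroup K →ₜ* Multiplicative ℤ_[p],
          ∃ a : Fin (nrComplexPlaces K + 1) → ℤ_[p], ∀ σ, (f σ).toAdd = ∑ i, a i * (Φ i σ).toAdd) :
    ∃ κ : ZpExtension K p, κ.IsAnticyclotomic := by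
  obtain ⟨c, hc, hc2⟩ := hconj
  have hG := dependent_of_zpRank_rat (hℚ units_rank_rat)
  have hH := exists_pair_of_zpRank hK himag (hKr (units_rank_eq_zero_of_finrank_eq_two hK himag))
  obtain ⟨κ, hsurj, hanti⟩ := IndexTwo.exists_surjective_anticyclotomic
    (GaloisRepresentations.absGaloisRestrict_injective ℚ K) hc hc2 hidx hG hH
  exact ⟨⟨κ, hsurj⟩, fun σ τ ρ hρ h => hanti σ τ ρ hρ h⟩

end NumberField

end ZpExtension

end Literature.NumberTheory.EllipticCurves
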